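import Summits.BirchSwinnertonDyer.Rank1Residual.X11b.BDPRouteNonsingularTorsionDivisible
import Summits.BirchSwinnertonDyer.Rank1Residual.X11b.BDPRouteControlBadPlaces
import Summits.BirchSwinnertonDyer.Rank1Residual.X11b.AnticyclotomicControlAtoms
import HarnessLib

/-!
# Class X11b, route p2: the one-sided control input (CTL≤)ᵗ with the bad-place kernels
# DISCHARGED — Greenberg's Lemma 3.3 (`#ker r_v ≤ c_v^{(p)}`) is now a theorem of the tree, so
# (CTL≤)ᵗ at a datum follows from ONE bound on `#Sel_𝔭(K, E[p^∞])` (cell `b2b-bsdres`,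
# sub-cell `multr1-p2`, gen 14)

HONEST FRAMING (verbatim, cell `b2b-bsdres`): the goal of the cell is to DELETE the
COMBINATION-SHAPED residual classes for ALL analytic-rank `≤ 1` curves over `ℚ` — "full BSD
formula for every rank `≤ 1` curve in class `C`" assembled STRICTLY from published theorems — so
that the rank-`≤ 1` remainder becomes exactly the CONSTRUCTION-SHAPED classes, which are TYPED
(missing-input Props), NOT attempted; this is not "finishing BSD". Research route `p2` for class
X11b; no claim beyond the stated class; nothing booked; X11b stays CONSTRUCTION-SHAPED. Theorems
only; no definition, no named fact, no `sorry`.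

## Content

Gen 13 (`BDPRouteControlBadPlaces`) reduced route p2's typed control input (T1ᵗ-CTL≤) at a datum to
(c) finiteness and bounds `#ker r_v ≤ p^{b v}` for Greenberg's local kernels at the places
`v ∈ Σ(N⁺)` (bad, `v ∤ p`) and (d) one bound `#Sel_𝔭(K, E[p^∞]) ≤ p^a`, with
`a + Σ b v ≤ ord_p #Ш(E/K)[p^∞] + 2((ord_p log_ω P − 1) − ord_p[E(K):ℤP]) + ord_p ∏_{w∣N⁺} c_w`.
This generation PROVED (c) with `b v = ord_p c_v(E_K)` for every elliptic curve over every number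
field, every `ℤ_p`-extension and every `v ∤ p`
(`natCard_localKer_le_pow_padicValNat_localTamagawaNumber`, file
`BDPRouteNonsingularTorsionDivisible`: Greenberg LNM 1716 Lemma 3.3 / proof of Thm. 4.1 in the
kernel). Hence:

* **`controlUpperOnTreeAt_of_selmerCardBound`** — (CTL≤)ᵗ at a datum (`K` quadratic totally
  complex, `κ` anticyclotomic, `E(K̄)[p^∞]^{D_𝔭 ⊓ ker κ} = 0`) from (d) ALONE: `Sel_𝔭(K, E[p^∞])`
  finite with `#Sel_𝔭(K, E[p^∞]) ≤ p^a` and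
  `a + Σ_{v ∈ Σ(N⁺)} ord_p c_v(E_K) ≤ ord_p #Ш + 2((ord_p log_ω P − 1) − ord_p I) + ord_p ∏_{w∣N⁺} c_w`.
* **`p2ControlUpperOnTreeAt_of_selmerCardBound`** — CLASS LEVEL: the typed input
  `P2ControlUpperOnTreeAt W p` of the statement of record `P2.bsdp_of_onTree_weakest` follows from
  the erratum's (iv) `E(ℚ_p)[p] = 0` and, at every p2 datum, the single Selmer cardinality bound (d)
  with that exponent inequality. In print (d) is Cas18 (3.2.1)+(calcul) in `≤` form
  (`#Sel_𝔭(K,E[p^∞]) ≤ #Ш[p^∞]·p^{2(ord_p c_p + ord_p log_ω P − 1 − ord_p I)}`, JSW Prop. 3.2.1 — the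
  reciprocity half of Poitou–Tate and Castella's local index at the multiplicative `𝔭`), and the
  exponent inequality is the Tamagawa bookkeeping `2 ord_p c_p + Σ_{Σ(N⁺)} ord_p c_w ≤ ord_p ∏_{w∣N⁺} c_w`.

* `…_above` variants: with `p ∣ N_E` split in `K` (automatic at a p2 datum), the Tamagawa bookkeeping
  `ord_p ∏_{w∣N⁺} c_w = ord_p ∏_{w∣p} c_w + Σ_{Σ(N⁺)} ord_p c_w` (sibling sub-cell,
  `padicValNat_tamagawaProductSplit_eq_above_add_sum`) turns the exponent condition into Castella's
  `a ≤ ord_p #Ш + 2((ord_p log_ω P − 1) − ord_p I) + ord_p ∏_{w∣p} c_w(E/K)` — (3.2.1)+(calcul) verbatim.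

So on the (iv)-part of X11b, (T1ᵗ-CTL≤) = kernel theorems + (d). CONDITIONAL (on (d)); nothing
booked; reach and labels unchanged.

References: [Castella2018] Thm. 2.3 and its proof (arXiv:1704.06608 pp. 5–6), (3.2.1);
[GreenbergLNM1716] §3 Lemma 3.3 (p. 87), p. 90; [JetchevSkinnerWan2017] Prop. 3.2.1 (shape only);
[Castella2018Erratum] Thm. 1.1 (iv).
-/

noncomputable section

open scoped Classical

open NumberField IsDedekindDomain Field WeierstrassCurve
open Literature.NumberTheory.EllipticCurves Literature.NumberTheory.EllipticCurves.GreenbergSelmer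
open Literature.NumberTheory.GaloisRepresentations
open Literature.NumberTheory.EllipticCurves.Rank1Residual
open Literature.NumberTheory.QuadraticFields.Quadratic

namespace Summit.BirchSwinnertonDyer.Rank1Residual.X11b

open AcSelmer

section Datum

variable {W : WeierstrassCurve ℚ} [W.IsElliptic] [W.IsGloballyMinimal] {K : Type} [Field K]
  [NumberField K] {p : ℕ} [Fact p.Prime] {κ : ZpExtension K p} {𝔭 : HeightOneSpectrum (𝓞 K)}
  {γ : Field.absoluteGaloisGroup K} [Fact (κ.IsTopGenerator γ)] {ι : K →+* ℚ_[p]}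

/-- **(CTL≤)ᵗ at a datum from ONE Selmer bound — the bad-place kernels are theorems.** For `E/ℚ`
over a quadratic totally complex `K`, an anticyclotomic `ℤ_p`-extension `κ` with generator `γ`, `𝔭`
with `E(K̄)[p^∞]^{D_𝔭 ⊓ ker κ} = 0`: if `Sel_𝔭(K, E[p^∞])` is finite with `#Sel_𝔭(K, E[p^∞]) ≤ p^a` and
`a + Σ_{v ∈ Σ(N⁺)} ord_p c_v(E_K) ≤ ord_p #Ш(E/K)[p^∞] + 2((ord_p log_ω P − 1) − ord_p[E(K):ℤP]) + ord_p ∏_{w∣N⁺} c_w`,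
then `ControlUpperOnTreeAt p κ 𝔭 γ ι P`. The local kernel bounds `#ker r_v ≤ c_v(E_K)^{(p)}` on
`Σ(N⁺)` (Greenberg Lemma 3.3) are supplied by `natCard_localKer_le_pow_padicValNat_localTamagawaNumber`.
[cite: Castella2018, Thm. 2.3 and its proof (arXiv:1704.06608 pp. 5–6)]
[cite: GreenbergLNM1716, §3 Lemma 3.3 (p. 87), p. 90] -/
theorem controlUpperOnTreeAt_of_selmerCardBound [IsTotallyComplex K] (hK : Module.finrank ℚ K = 2)
    (hκ : κ.IsAnticyclotomic)
    (h0 : FixedPoints.addSubgroup ↥(decomp 𝔭 ⊓ κ.kerSubgroup)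
      ((W.baseChange K).geomPrimaryTorsion p) = ⊥)
    [Finite (selmerAcBase (W.baseChange K) p 𝔭 ∅)]
    {a : ℕ} (ha : Nat.card (selmerAcBase (W.baseChange K) p 𝔭 ∅) ≤ p ^ a)
    {P : (W.baseChange K).toAffine.Point}
    (hm : ((a + ∑ v ∈ (nPlusPlaces_finite (W := W) (K := K) (p := p) hK).toFinset,
        padicValNat p (((W.baseChange K).baseChange (v.adicCompletion K)).localTamagawaNumber
          (v.adicCompletionIntegers K)) : ℕ) : ℤ) ≤
      (padicValNat p (Nat.card (AddCommGroup.primaryComponent (W.baseChange K).sha p)) : ℤ) +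
      2 * ((padicLogOrd W p ι P - 1) - (padicValNat p (AddSubgroup.zmultiples P).index : ℤ)) +
        padicValNat p (tamagawaProductSplit W K)) :
    ControlUpperOnTreeAt p κ 𝔭 γ ι P := by
  haveI hEK : (W.baseChange K).IsElliptic := by rw [baseChange]; infer_instance
  have hpv : ∀ v ∈ (nPlusPlaces_finite (W := W) (K := K) (p := p) hK).toFinset,
      ((p : ℕ) : 𝓞 K) ∉ v.asIdeal := fun v hv ↦
    (((nPlusPlaces_finite (W := W) (K := K) (p := p) hK).mem_toFinset).mp hv).1
  exact controlUpperOnTreeAt_of_nPlus_bounds hK hκ h0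
    (fun v hv ↦ (natCard_localKer_le_pow_padicValNat_localTamagawaNumber (W.baseChange K) κ
      (hpv v hv)).1) ha
    (fun v hv ↦ (natCard_localKer_le_pow_padicValNat_localTamagawaNumber (W.baseChange K) κ
      (hpv v hv)).2) hm

/-- **(CTL≤)ᵗ at a datum from ONE Selmer bound, Castella's shape.** With `p ∣ N_E` split in the
quadratic `K`, the Tamagawa term splits as `ord_p ∏_{w∣N⁺} c_w = ord_p ∏_{w∣p} c_w + Σ_{v∈Σ(N⁺)} ord_p c_v`
(sibling sub-cell, `padicValNat_tamagawaProductSplit_eq_above_add_sum`), so the hypothesis becomes: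
`Sel_𝔭(K, E[p^∞])` finite, `#Sel_𝔭(K, E[p^∞]) ≤ p^a`,
`a ≤ ord_p #Ш(E/K)[p^∞] + 2((ord_p log_ω P − 1) − ord_p[E(K):ℤP]) + ord_p ∏_{w∣p} c_w(E/K)` — in print
Cas18 (3.2.1)+(calcul) (`∏_{w∣p} c_w(E/K) = c_p(E)²` as `K_𝔭 = K_𝔭̄ = ℚ_p`).
[cite: Castella2018, Thm. 2.3 and its proof, (3.2.1) (arXiv:1704.06608 pp. 5–6)]
[cite: GreenbergLNM1716, §3 Lemma 3.3 (p. 87), p. 90] -/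
theorem controlUpperOnTreeAt_of_selmerCardBound_above [IsTotallyComplex K]
    (hK : Module.finrank ℚ K = 2) (hκ : κ.IsAnticyclotomic)
    (h0 : FixedPoints.addSubgroup ↥(decomp 𝔭 ⊓ κ.kerSubgroup)
      ((W.baseChange K).geomPrimaryTorsion p) = ⊥)
    (hsplit : SplitsIn K p) (hpN : p ∣ W.conductorNorm ℤ)
    [Finite (selmerAcBase (W.baseChange K) p 𝔭 ∅)]
    {a : ℕ} (ha : Nat.card (selmerAcBase (W.baseChange K) p 𝔭 ∅) ≤ p ^ a)
    {P : (W.baseChange K).toAffine.Point}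
    (hm : (a : ℤ) ≤
      (padicValNat p (Nat.card (AddCommGroup.primaryComponent (W.baseChange K).sha p)) : ℤ) +
      2 * ((padicLogOrd W p ι P - 1) - (padicValNat p (AddSubgroup.zmultiples P).index : ℤ)) +
        padicValNat p (tamagawaProductAbove W K p)) :
    ControlUpperOnTreeAt p κ 𝔭 γ ι P := by
  refine controlUpperOnTreeAt_of_selmerCardBound hK hκ h0 ha ?_
  rw [padicValNat_tamagawaProductSplit_eq_above_add_sum W p hK hsplit hpN, Nat.cast_add, Nat.cast_add]
  linarith

end Datum

/-! ## Class level: `P2ControlUpperOnTreeAt` from (iv) and one Selmer bound per datum -/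

section ClassLevel

variable {W : WeierstrassCurve ℚ} [W.IsElliptic] [W.IsGloballyMinimal] {p : ℕ} [Fact p.Prime]

/-- **The typed input (T1ᵗ-CTL≤) of the statement of record from (iv) + ONE Selmer bound per
datum.** `P2ControlUpperOnTreeAt W p` (Cas18 Thm. 2.3 `≤`, the input of `P2.bsdp_of_onTree_weakest`)
follows from the erratum's hypothesis (iv) `E(ℚ_p)[p] = 0` together with, at every p2 datum
(Heegner field `K`, anticyclotomic `κ`, generator `γ`, degree-one `𝔭 ∣ p`, non-torsion `P`):
finiteness of `Sel_𝔭(K, E[p^∞])` and a bound `#Sel_𝔭(K, E[p^∞]) ≤ p^a` with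
`a + Σ_{v∈Σ(N⁺)} ord_p c_v(E_K) ≤ ord_p #Ш(E/K)[p^∞] + 2((ord_p log_ω P − 1) − ord_p[E(K):ℤP]) + ord_p ∏_{w∣N⁺} c_w`.
The bad-place kernel bounds of gen 13's package are no longer hypotheses: Greenberg's Lemma 3.3
with the Tamagawa bound is the tree theorem `natCard_localKer_le_pow_padicValNat_localTamagawaNumber`.
In print the remaining hypothesis is Cas18 (3.2.1)+(calcul) in `≤` form (JSW Prop. 3.2.1,
Poitou–Tate) plus the Tamagawa bookkeeping `2 ord_p c_p + Σ_{Σ(N⁺)} ord_p c_w ≤ ord_p ∏_{w∣N⁺} c_w`;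
it is a HYPOTHESIS here (stated inline; nothing asserted). CONDITIONAL; nothing booked.
[cite: Castella2018, Thm. 2.3 and its proof, (3.2.1) (arXiv:1704.06608 pp. 5–6)]
[cite: Castella2018Erratum, Thm. 1.1 (iv)] [cite: GreenbergLNM1716, §3 Lemma 3.3 (p. 87)] -/
theorem p2ControlUpperOnTreeAt_of_selmerCardBound
    (hiv : ∀ Q : (W.baseChange ℚ_[p]).toAffine.Point, p • Q = 0 → Q = 0)
    (hsel : ∀ (K : Type) [Field K] [NumberField K] (hK : IsImaginaryQuadratic K)
      (κ : ZpExtension K p), κ.IsAnticyclotomic →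
      ∀ (γ : Field.absoluteGaloisGroup K) [Fact (κ.IsTopGenerator γ)]
        (𝔭 : HeightOneSpectrum (𝓞 K)) (h𝔭 : ((p : ℕ) : 𝓞 K) ∈ 𝔭.asIdeal)
        (he : 𝔭.asIdeal.ramificationIdx (𝓞 ℚ) = 1) (hf : 𝔭.asIdeal.inertiaDeg (𝓞 ℚ) = 1)
        (P : (W.baseChange K).toAffine.Point), ¬ IsOfFinAddOrder P →
        ∃ (_ : Finite (selmerAcBase (W.baseChange K) p 𝔭 ∅)) (a : ℕ),
          Nat.card (selmerAcBase (W.baseChange K) p 𝔭 ∅) ≤ p ^ a ∧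
          ((a + ∑ v ∈ (nPlusPlaces_finite (W := W) (K := K) (p := p) hK.1).toFinset,
              padicValNat p (((W.baseChange K).baseChange (v.adicCompletion K)).localTamagawaNumber
                (v.adicCompletionIntegers K)) : ℕ) : ℤ) ≤
            (padicValNat p (Nat.card (AddCommGroup.primaryComponent (W.baseChange K).sha p)) : ℤ) +
            2 * ((padicLogOrd W p (embAt K p 𝔭 h𝔭 he hf) P - 1) -
              (padicValNat p (AddSubgroup.zmultiples P).index : ℤ)) +
              padicValNat p (tamagawaProductSplit W K)) :
    P2ControlUpperOnTreeAt W p := by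
  intro N _ K _ _ Dt H ι P _ _ _ _ hK _ _ _ _ _ _ _ hPinf κ hκ γ _ 𝔭 h𝔭 he hf
  haveI : IsTotallyComplex K := hK.2
  obtain ⟨hfinK, a, ha, hm⟩ := hsel K hK κ hκ γ 𝔭 h𝔭 he hf P hPinf
  haveI := hfinK
  -- (iv) ⟹ `E(K̄)[p^∞]^{D_𝔭 ⊓ ker κ} = 0` (the sibling's descent along `K_𝔭 ≅ ℚ_p`)
  obtain ⟨e⟩ := exists_ringHom_adicCompletion_padic_of_degreeOne p 𝔭 h𝔭 he hf
  have hKv := noPTorsion_baseChange_adicCompletion_of_padic W p 𝔭 e hiv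
  have h0 : FixedPoints.addSubgroup ↥(decomp 𝔭 ⊓ κ.kerSubgroup)
      ((W.baseChange K).geomPrimaryTorsion p) = ⊥ := by
    refine fixedPoints_decomp_inf_kerSubgroup_eq_bot κ (W.baseChange K) 𝔭 fun m hfix hpm ↦
      eq_zero_of_fixed_decomp_of_local (W.baseChange K) p 𝔭 ?_ m hfix hpm
    exact hKv
  exact controlUpperOnTreeAt_of_selmerCardBound hK.1 hκ h0 ha hm

/-- **(T1ᵗ-CTL≤) from (iv) + ONE Selmer bound per datum, Castella's shape.** `P2ControlUpperOnTreeAt W p`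
follows from (iv) `E(ℚ_p)[p] = 0` and, at every p2 datum, finiteness of `Sel_𝔭(K, E[p^∞])` with
`#Sel_𝔭(K, E[p^∞]) ≤ p^a`, `a ≤ ord_p #Ш(E/K)[p^∞] + 2((ord_p log_ω P − 1) − ord_p[E(K):ℤP]) + ord_p ∏_{w∣p} c_w(E/K)`
— exactly Cas18 (3.2.1)+(calcul) in `≤` form (JSW Prop. 3.2.1: the reciprocity half of Poitou–Tate and
the local index at the multiplicative `𝔭`), the ONLY remaining non-kernel input of (CTL≤)ᵗ on the
(iv)-part of X11b (`p ∣ N_E` and its splitting in the Heegner field `K` come from the datum). It is a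
HYPOTHESIS here (stated inline; nothing asserted). CONDITIONAL; nothing booked.
[cite: Castella2018, Thm. 2.3 and its proof, (3.2.1) (arXiv:1704.06608 pp. 5–6)]
[cite: Castella2018Erratum, Thm. 1.1 (iv)] [cite: JetchevSkinnerWan2017, Prop. 3.2.1 (shape only)] -/
theorem p2ControlUpperOnTreeAt_of_selmerCardBound_above
    (hiv : ∀ Q : (W.baseChange ℚ_[p]).toAffine.Point, p • Q = 0 → Q = 0)
    (hsel : ∀ (K : Type) [Field K] [NumberField K] (_hK : IsImaginaryQuadratic K)
      (κ : ZpExtension K p), κ.IsAnticyclotomic →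
      ∀ (γ : Field.absoluteGaloisGroup K) [Fact (κ.IsTopGenerator γ)]
        (𝔭 : HeightOneSpectrum (𝓞 K)) (h𝔭 : ((p : ℕ) : 𝓞 K) ∈ 𝔭.asIdeal)
        (he : 𝔭.asIdeal.ramificationIdx (𝓞 ℚ) = 1) (hf : 𝔭.asIdeal.inertiaDeg (𝓞 ℚ) = 1)
        (P : (W.baseChange K).toAffine.Point), ¬ IsOfFinAddOrder P →
        ∃ (_ : Finite (selmerAcBase (W.baseChange K) p 𝔭 ∅)) (a : ℕ),
          Nat.card (selmerAcBase (W.baseChange K) p 𝔭 ∅) ≤ p ^ a ∧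
          (a : ℤ) ≤
            (padicValNat p (Nat.card (AddCommGroup.primaryComponent (W.baseChange K).sha p)) : ℤ) +
            2 * ((padicLogOrd W p (embAt K p 𝔭 h𝔭 he hf) P - 1) -
              (padicValNat p (AddSubgroup.zmultiples P).index : ℤ)) +
              padicValNat p (tamagawaProductAbove W K p)) :
    P2ControlUpperOnTreeAt W p := by
  intro N _ K _ _ Dt H ι P hX _ _ hN hK _ _ _ hHN _ _ _ hPinf κ hκ γ _ 𝔭 h𝔭 he hf
  haveI : IsTotallyComplex K := hK.2
  obtain ⟨-, -, hmult, -⟩ := hX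
  have hpN : p ∣ W.conductorNorm ℤ := dvd_conductorNorm_of_mult hmult
  have hsplit : SplitsIn K p := hHN p Fact.out (hN ▸ hpN)
  obtain ⟨hfinK, a, ha, hm⟩ := hsel K hK κ hκ γ 𝔭 h𝔭 he hf P hPinf
  haveI := hfinK
  -- (iv) ⟹ `E(K̄)[p^∞]^{D_𝔭 ⊓ ker κ} = 0`
  obtain ⟨e⟩ := exists_ringHom_adicCompletion_padic_of_degreeOne p 𝔭 h𝔭 he hf
  have hKv := noPTorsion_baseChange_adicCompletion_of_padic W p 𝔭 e hiv
  have h0 : FixedPoints.addSubgroup ↥(decomp 𝔭 ⊓ κ.kerSubgroup)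
      ((W.baseChange K).geomPrimaryTorsion p) = ⊥ := by
    refine fixedPoints_decomp_inf_kerSubgroup_eq_bot κ (W.baseChange K) 𝔭 fun m hfix hpm ↦
      eq_zero_of_fixed_decomp_of_local (W.baseChange K) p 𝔭 ?_ m hfix hpm
    exact hKv
  exact controlUpperOnTreeAt_of_selmerCardBound_above hK.1 hκ h0 hsplit hpN ha hm

end ClassLevel

end Summit.BirchSwinnertonDyer.Rank1Residual.X11b

end
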